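/-
Copyright: the b2b-balaban cell (near-miss cell 7), T⁴-continuum CRUX team (coordinator ruling e34b3e0c item (2)),
seat t4-ne7b-formalise-leaf-06 (gen 28). Released under the licence of the surrounding project.
-/
import Summits.QuantumFields.BalabanUV.T4Continuum.Spine.NE7b.QuaternionBianchiDefect

/-!
# PH-k (β₄), part A: the covariant lattice divergence of the sine-curvature, its Euler–Lagrange form, and the
# transport algebra (route NE7b R-H, `t4/ROUTES-NE7b.md` v5 §2 PH-k (α), (β₁), (β₄); PRICING-NE7b v5 F23c)

Cell `pub-balaban`, sub-cell `t4`, spine estimate NE7b (node U5c), candidate route R-H «Peierls healing map», lemma PH-k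
(discrete Bochner–Weitzenböck barrier for the interior-free `SU(2)` minimiser; ROUTES-NE7b v5 §2, seat `t4-ne7b-idea-1`
gen 5). The refuter's PRICING-NE7b v5 (F23c) prices PH-k's components: (β₁)(β₂) K-LANDED (`QuaternionBianchiDefect`,
p253069∕p253251), (β₃) K-LANDED (`AbelianCurvatureMaximumPrinciple`, p252419), (γ) K-LANDED (`LatticeSubsolutionBarrier`,
p252732), and **(β₄) «MEAN-VALUE INEQUALITY … the bookkeeping of `C′_d` is the one place where work remains» — ACCEPT
[NEW-local, M-small], worth a seat**. This file and its sequel `CovariantMeanValueInequality` supply (β₄) in the kernel.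

MODEL (as in `QuaternionBianchiDefect` §6). `G :=` the unit quaternions `Metric.sphere (0 : ℍ) 1` (our stand-in for
`SU(2)`), a configuration `U : ZdGaugeConfig d G` on `ℤ^d`, the plaquette holonomy
`P_{ij}(x) = U(x,i) U(x+eᵢ,j) U(x+eⱼ,i)⁻¹ U(x,j)⁻¹` (`ZdGaugeConfig.plaquette`, based at `x`), and v5 (α)'s variable: the
**sine-curvature** `E_{ij}(x) := Im P_{ij}(x) ∈ Im ℍ ≅ ℝ³` (`curv`; `‖E‖ = sin θ`).

CONTENTS.
* §1 plaquette bookkeeping in any group: `plaquette_self` (`P_{ii} = 1`), `plaquette_swap` (`P_{ji} = P_{ij}⁻¹`), the two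
  staples closing to the plaquettes above∕below a link.
* §2 the TRANSPORT `Ad g : ℍ →ₗ[ℝ] ℍ`, `q ↦ g q g*` (parallel transport of `Im ℍ`-valued quantities along a link):
  composition, inverses, `Re`∕`Im`∕norm preserved, and the COST OF A TRANSPORT AROUND A PLAQUETTE
  **`norm_Ad_sub_self_le`**: `‖Ad W v − v‖ ≤ 2‖Im W‖·‖v‖` (v5 (β₄): «each transport around a plaquette costs
  `‖Ad(U_p) − 1‖ ≤ 2 s_p`»).
* §3 `curv` and the **covariant divergence** at the link `(x,i)`:
  `covDiv U x i := Σ_k [E_{ik}(x) − Ad(U(x−e_k,k))⁻¹ E_{ik}(x−e_k)]` — the `2(d−1)` plaquettes through the link, the lower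
  ones transported to `x` along the link `(x−e_k,k)` (the `k = i` summand vanishes, `covDivSummand_self`).
* §4 the **staple sum** `staple U x i` (the `2(d−1)` open three-link paths completing the link to a plaquette, as
  quaternions) and the two identities that make (β₁) a statement about THIS lattice:
  **`re_mul_staple`** — `Re(U(x,i)·S) = Σ_{k≠i} [Re P_{ik}(x) + Re P_{ik}(x−e_k)]` (the Wilson action's plaquettes through
  the link) and **`im_mul_staple`** — `Im(U(x,i)·S) = covDiv U x i`. With `QuaternionBianchiDefect.critical_iff_im_eq_zero`
  ((β₁), p253069): **`critical_iff_covDiv_eq_zero`** — the link variable is critical for `V ↦ Re(V·S)` along every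
  tangent direction of the unit sphere iff the covariant divergence of `E` vanishes at that link: the lattice Yang–Mills
  equation, EXACT and LINEAR in `E`, no small-field hypothesis; `staple_update` — `S` does not involve `U(x,i)`.

HONEST FRAMING. Law-free algebra about ONE lattice configuration; no measure, no effective action, no constant of
[Bałaban 1983–89] asserted or cited; the `specialUnitaryGroup (Fin 2) ℂ ≃` unit-quaternion bridge is NOT formalised here.
(β₄)'s inequality and constant are in the sequel file. NE7b (`T4WeightBudget.RelWeightBound`) NOT PRINTED, NOT PROVED;
spine PROVED 0∕9; rung (B)+1 on a FINITE torus T⁴ — NOT infinite volume, NOT the mass gap, NOT Clay. HONEST DEPENDENCY: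
continuum YM on T⁴ ⇐ BetaPertH ∧ nine spine estimates (0/9 proved); BetaPertH ⇐ (D1) ∧ (D4) ∧ CAP+tail; G-an2-4 gates
asym, D1 and NE2/3/4. POLICY: crux-route work under `Spine/NE7b/` (coordinator FREEZE (0) respected: not a
`T4Continuum/Support` leaf, not a folklore-algebra module — it is ROUTES v5's named item (β₄)); concrete `ℍ`-valued
definitions only, no `Prop`-valued fact, no `[cite:]` fact.
-/

set_option autoImplicit false

namespace Summit.QuantumFields.BalabanUV.T4Continuum.NE7b.CovariantDivergenceEL

noncomputable section

open Quaternion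
open scoped Quaternion
open Literature.MathematicalPhysics.QuantumFieldTheory (ZdEdge ZdGaugeConfig)
open Literature.Probability.LatticeModels (Site)
open Summit.QuantumFields.BalabanUV.T4Continuum.NE7b.QuaternionBianchiDefect
  (norm_coe_sphere coe_inv_eq_star re_coe_inv im_coe_inv critical_iff_im_eq_zero)

/-! ## §1 Plaquette bookkeeping (any group) -/

section AnyGroup

variable {d : ℕ} {G : Type*} [Group G]

/-- A degenerate plaquette `P_{ii}(x)` is trivial. -/
theorem plaquette_self (U : ZdGaugeConfig d G) (x : Site d) (i : Fin d) : ZdGaugeConfig.plaquette U x i i = 1 := by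
  simp [ZdGaugeConfig.plaquette]

/-- Reversing the orientation inverts the holonomy: `P_{ji}(x) = P_{ij}(x)⁻¹`. -/
theorem plaquette_swap (U : ZdGaugeConfig d G) (x : Site d) (i j : Fin d) :
    ZdGaugeConfig.plaquette U x j i = (ZdGaugeConfig.plaquette U x i j)⁻¹ := by
  simp only [ZdGaugeConfig.plaquette, mul_inv_rev, inv_inv, mul_assoc]

/-- The upper staple closes to the plaquette: `U(x,i)·[U(x+eᵢ,k) U(x+e_k,i)⁻¹ U(x,k)⁻¹] = P_{ik}(x)`. -/
theorem mul_stapleUp (U : ZdGaugeConfig d G) (x : Site d) (i k : Fin d) :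
    U (x, i) * (U (x + Pi.single i 1, k) * (U (x + Pi.single k 1, i))⁻¹ * (U (x, k))⁻¹) =
      ZdGaugeConfig.plaquette U x i k := by
  simp only [ZdGaugeConfig.plaquette, mul_assoc]

/-- The lower staple closes to the INVERSE of the plaquette below, transported to `x` along the link `(x−e_k, k)`:
`U(x,i)·[U(x+eᵢ−e_k,k)⁻¹ U(x−e_k,i)⁻¹ U(x−e_k,k)] = U(x−e_k,k)⁻¹ · P_{ik}(x−e_k)⁻¹ · U(x−e_k,k)`. -/
theorem mul_stapleDown (U : ZdGaugeConfig d G) (x : Site d) (i k : Fin d) :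
    U (x, i) * ((U (x + Pi.single i 1 - Pi.single k 1, k))⁻¹ * (U (x - Pi.single k 1, i))⁻¹ * U (x - Pi.single k 1, k)) =
      (U (x - Pi.single k 1, k))⁻¹ * (ZdGaugeConfig.plaquette U (x - Pi.single k 1) i k)⁻¹ * U (x - Pi.single k 1, k) := by
  have h1 : x - Pi.single k 1 + Pi.single i 1 = x + Pi.single i 1 - Pi.single k 1 := sub_add_eq_add_sub _ _ _
  have h2 : x - Pi.single k 1 + Pi.single k 1 = x := sub_add_cancel _ _
  simp only [ZdGaugeConfig.plaquette, h1, h2, mul_inv_rev, inv_inv, mul_assoc, inv_mul_cancel_left]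

end AnyGroup

/-! ## §2 Transport on `ℍ` by unit quaternions -/

/-- `g · g* = 1` for a unit quaternion. -/
theorem coe_mul_star_coe (g : (Metric.sphere (0 : ℍ) 1)) : (g : ℍ) * star (g : ℍ) = 1 := by
  rw [Quaternion.self_mul_star, Quaternion.normSq_eq_norm_mul_self, norm_coe_sphere, mul_one]; norm_cast

/-- `g* · g = 1` for a unit quaternion. -/
theorem star_coe_mul_coe (g : (Metric.sphere (0 : ℍ) 1)) : star (g : ℍ) * (g : ℍ) = 1 := by
  rw [Quaternion.star_mul_self, Quaternion.normSq_eq_norm_mul_self, norm_coe_sphere, mul_one]; norm_cast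

/-- **Transport** by a unit quaternion `g`: the `ℝ`-linear map `q ↦ g q g*` of `ℍ` (on `Im ℍ ≅ ℝ³` this is the rotation
`Ad g ∈ SO(3)`; it carries an `Im ℍ`-valued quantity read at the far end of a link back to its near end). -/
def Ad (g : (Metric.sphere (0 : ℍ) 1)) : ℍ →ₗ[ℝ] ℍ where
  toFun q := (g : ℍ) * q * star (g : ℍ)
  map_add' q r := by simp only [mul_add, add_mul]
  map_smul' c q := by simp only [RingHom.id_apply, mul_smul_comm, smul_mul_assoc]

/-- Unfolding `Ad`. -/
theorem Ad_apply (g : (Metric.sphere (0 : ℍ) 1)) (q : ℍ) : Ad g q = (g : ℍ) * q * star (g : ℍ) := rfl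

/-- Group conjugation, coerced, is transport: `↑(g p g⁻¹) = Ad g ↑p`. -/
theorem coe_conj (g p : (Metric.sphere (0 : ℍ) 1)) :
    ((g * p * g⁻¹ : (Metric.sphere (0 : ℍ) 1)) : ℍ) = Ad g (p : ℍ) := by
  rw [Ad_apply, Metric.unitSphere.coe_mul, Metric.unitSphere.coe_mul, coe_inv_eq_star]

/-- Transport by `1` is the identity. -/
theorem Ad_one (q : ℍ) : Ad 1 q = q := by
  rw [Ad_apply, Metric.unitSphere.coe_one, star_one, one_mul, mul_one]

/-- Transports compose: `Ad (g h) = Ad g ∘ Ad h`. -/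
theorem Ad_mul (g h : (Metric.sphere (0 : ℍ) 1)) (q : ℍ) : Ad (g * h) q = Ad g (Ad h q) := by
  simp only [Ad_apply, Metric.unitSphere.coe_mul, star_mul, mul_assoc]

/-- Transport by the inverse: `Ad g⁻¹ q = g* q g`. -/
theorem Ad_inv_apply (g : (Metric.sphere (0 : ℍ) 1)) (q : ℍ) : Ad g⁻¹ q = star (g : ℍ) * q * (g : ℍ) := by
  rw [Ad_apply, coe_inv_eq_star, star_star]

/-- `Ad g⁻¹ ∘ Ad g = id`. -/
theorem Ad_inv_Ad (g : (Metric.sphere (0 : ℍ) 1)) (q : ℍ) : Ad g⁻¹ (Ad g q) = q := by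
  rw [← Ad_mul, inv_mul_cancel, Ad_one]

/-- `Ad g ∘ Ad g⁻¹ = id`. -/
theorem Ad_Ad_inv (g : (Metric.sphere (0 : ℍ) 1)) (q : ℍ) : Ad g (Ad g⁻¹ q) = q := by
  rw [← Ad_mul, mul_inv_cancel, Ad_one]

/-- Transport fixes the reals. -/
theorem Ad_coe_real (g : (Metric.sphere (0 : ℍ) 1)) (r : ℝ) : Ad g (r : ℍ) = r := by
  rw [Ad_apply, ← Quaternion.coe_commutes r (g : ℍ), mul_assoc, coe_mul_star_coe, mul_one]

/-- Transport preserves the real part … -/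
theorem re_Ad (g : (Metric.sphere (0 : ℍ) 1)) (q : ℍ) : (Ad g q).re = q.re := by
  have re_mul_comm : ∀ a b : ℍ, (a * b).re = (b * a).re := fun a b => by
    rw [Quaternion.re_mul, Quaternion.re_mul]; ring
  rw [Ad_apply, re_mul_comm, ← mul_assoc, star_coe_mul_coe, one_mul]

/-- … commutes with taking the imaginary part … -/
theorem im_Ad (g : (Metric.sphere (0 : ℍ) 1)) (q : ℍ) : (Ad g q).im = Ad g q.im := by
  rw [← Quaternion.sub_re_self, re_Ad, ← Quaternion.sub_re_self q, map_sub, Ad_coe_real]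

/-- … in particular transports of sine-curvatures stay purely imaginary … -/
theorem re_Ad_im (g : (Metric.sphere (0 : ℍ) 1)) (q : ℍ) : (Ad g q.im).re = 0 := by
  rw [re_Ad, Quaternion.re_im]

/-- … and preserves the norm («transported `E` = rotated `E`»). -/
theorem norm_Ad (g : (Metric.sphere (0 : ℍ) 1)) (q : ℍ) : ‖Ad g q‖ = ‖q‖ := by
  rw [Ad_apply, norm_mul, norm_mul, Quaternion.norm_star, norm_coe_sphere, one_mul, mul_one]

/-- **THE COST OF A TRANSPORT AROUND A PLAQUETTE.** For a unit quaternion `W` and any `v`: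
`‖Ad W v − v‖ ≤ 2‖Im W‖·‖v‖` (`W v − v W = (Im W) v − v (Im W)`, the real part commuting). With `W` a plaquette
holonomy this is v5 (β₄)'s «`‖Ad(U_p) − 1‖ ≤ 2 s_p`». -/
theorem norm_Ad_sub_self_le (W : (Metric.sphere (0 : ℍ) 1)) (v : ℍ) : ‖Ad W v - v‖ ≤ 2 * ‖(W : ℍ).im‖ * ‖v‖ := by
  have hW : (W : ℍ) = (((W : ℍ).re : ℝ) : ℍ) + (W : ℍ).im := (Quaternion.re_add_im _).symm
  have h1 : Ad W v - v = ((W : ℍ).im * v - v * (W : ℍ).im) * star (W : ℍ) := by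
    calc Ad W v - v = ((W : ℍ) * v - v * (W : ℍ)) * star (W : ℍ) := by
          rw [sub_mul, mul_assoc v, coe_mul_star_coe, mul_one, Ad_apply]
      _ = ((W : ℍ).im * v - v * (W : ℍ).im) * star (W : ℍ) := by
          congr 1
          conv_lhs => rw [hW]
          rw [add_mul, mul_add, Quaternion.coe_commutes]
          abel
  rw [h1, norm_mul, Quaternion.norm_star, norm_coe_sphere, mul_one]
  calc ‖(W : ℍ).im * v - v * (W : ℍ).im‖ ≤ ‖(W : ℍ).im * v‖ + ‖v * (W : ℍ).im‖ := norm_sub_le _ _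
    _ ≤ ‖(W : ℍ).im‖ * ‖v‖ + ‖v‖ * ‖(W : ℍ).im‖ := add_le_add (norm_mul_le _ _) (norm_mul_le _ _)
    _ = 2 * ‖(W : ℍ).im‖ * ‖v‖ := by ring

/-- Two transports that differ by a plaquette: if `b = W·a` then `‖Ad b u − Ad a u‖ ≤ 2‖Im W‖·‖u‖`. -/
theorem norm_Ad_sub_Ad_le (W a b : (Metric.sphere (0 : ℍ) 1)) (hb : b = W * a) (u : ℍ) :
    ‖Ad b u - Ad a u‖ ≤ 2 * ‖(W : ℍ).im‖ * ‖u‖ := by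
  rw [hb, Ad_mul, ← norm_Ad a u]
  exact norm_Ad_sub_self_le W (Ad a u)

-- `Im` of a finite sum is the tree's `Federbush1986.SU2.im_sum` (imported via `QuaternionBianchiDefect`, not restated).

/-- `Re` of a finite sum. -/
theorem re_finset_sum {ι : Type*} (s : Finset ι) (f : ι → ℍ) : (∑ i ∈ s, f i).re = ∑ i ∈ s, (f i).re := by
  induction s using Finset.cons_induction with
  | empty => simp
  | cons a s ha ih => rw [Finset.sum_cons, Finset.sum_cons, Quaternion.re_add, ih]

/-! ## §3 The sine-curvature and its covariant divergence -/

section Lattice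

variable {d : ℕ}

/-- v5 (α)'s variable: the **sine-curvature** `E_{ij}(x) := Im P_{ij}(x)` of the plaquette at `x` in the `(i,j)` plane,
based at `x` (`‖E‖ = sin θ_p`; gauge-COvariant: a change of base point acts by a transport `Ad`). -/
def curv (U : ZdGaugeConfig d (Metric.sphere (0 : ℍ) 1)) (x : Site d) (i j : Fin d) : ℍ :=
  ((ZdGaugeConfig.plaquette U x i j : (Metric.sphere (0 : ℍ) 1)) : ℍ).im

/-- `E` is purely imaginary. -/
theorem re_curv (U : ZdGaugeConfig d (Metric.sphere (0 : ℍ) 1)) (x : Site d) (i j : Fin d) : (curv U x i j).re = 0 :=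
  Quaternion.re_im _

/-- `E_{ii} = 0`. -/
theorem curv_self (U : ZdGaugeConfig d (Metric.sphere (0 : ℍ) 1)) (x : Site d) (i : Fin d) : curv U x i i = 0 := by
  rw [curv, plaquette_self, Metric.unitSphere.coe_one]; rfl

/-- `E_{ji} = −E_{ij}` (orientation reversal = inversion = conjugation). -/
theorem curv_swap (U : ZdGaugeConfig d (Metric.sphere (0 : ℍ) 1)) (x : Site d) (i j : Fin d) :
    curv U x j i = -curv U x i j := by
  rw [curv, plaquette_swap, im_coe_inv]; rfl

/-- `‖E‖ ≤ 1` (`= sin θ`). -/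
theorem norm_curv_le_one (U : ZdGaugeConfig d (Metric.sphere (0 : ℍ) 1)) (x : Site d) (i j : Fin d) :
    ‖curv U x i j‖ ≤ 1 :=
  (Literature.MathematicalPhysics.QuantumFieldTheory.Federbush1986.SU2.norm_im_le _).trans (norm_coe_sphere _).le

/-- The `k`-th summand of the covariant divergence at the link `(x,i)`: the plaquette `P_{ik}(x)` above the link and the
plaquette `P_{ik}(x−e_k)` below it, the latter INVERTED (it is traversed against its orientation) and TRANSPORTED to `x`
along the link `(x−e_k,k)`. -/
def covDivSummand (U : ZdGaugeConfig d (Metric.sphere (0 : ℍ) 1)) (x : Site d) (i k : Fin d) : ℍ :=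
  curv U x i k - Ad (U (x - Pi.single k 1, k))⁻¹ (curv U (x - Pi.single k 1) i k)

/-- **The covariant lattice divergence of `E` at the link `(x,i)`**: `Σ_k [E_{ik}(x) − Ad(U(x−e_k,k))⁻¹ E_{ik}(x−e_k)]`
— the signed, transported sum of the sine-curvatures of the `2(d−1)` plaquettes through the link (the `k = i` summand is
`0`). Its vanishing is the lattice Yang–Mills equation at that link (`critical_iff_covDiv_eq_zero`). -/
def covDiv (U : ZdGaugeConfig d (Metric.sphere (0 : ℍ) 1)) (x : Site d) (i : Fin d) : ℍ :=
  ∑ k : Fin d, covDivSummand U x i k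

/-- The degenerate summand `k = i` vanishes. -/
theorem covDivSummand_self (U : ZdGaugeConfig d (Metric.sphere (0 : ℍ) 1)) (x : Site d) (i : Fin d) :
    covDivSummand U x i i = 0 := by
  rw [covDivSummand, curv_self, curv_self, map_zero, sub_zero]

/-- `covDiv` is purely imaginary. -/
theorem re_covDiv (U : ZdGaugeConfig d (Metric.sphere (0 : ℍ) 1)) (x : Site d) (i : Fin d) : (covDiv U x i).re = 0 := by
  rw [covDiv, re_finset_sum]
  refine Finset.sum_eq_zero fun k _ => ?_
  rw [covDivSummand, Quaternion.re_sub, re_curv, curv, re_Ad_im, sub_zero]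

/-! ## §4 The staple sum and the Euler–Lagrange form of criticality -/

/-- The upper staple through the link `(x,i)` in the `(i,k)` plane, as a group element. -/
def stapleUp (U : ZdGaugeConfig d (Metric.sphere (0 : ℍ) 1)) (x : Site d) (i k : Fin d) : (Metric.sphere (0 : ℍ) 1) :=
  U (x + Pi.single i 1, k) * (U (x + Pi.single k 1, i))⁻¹ * (U (x, k))⁻¹

/-- The lower staple through the link `(x,i)` in the `(i,k)` plane, as a group element. -/
def stapleDown (U : ZdGaugeConfig d (Metric.sphere (0 : ℍ) 1)) (x : Site d) (i k : Fin d) : (Metric.sphere (0 : ℍ) 1) :=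
  (U (x + Pi.single i 1 - Pi.single k 1, k))⁻¹ * (U (x - Pi.single k 1, i))⁻¹ * U (x - Pi.single k 1, k)

/-- **The staple sum** `S(x,i) := Σ_{k ≠ i} [stapleUp + stapleDown]` of the link `(x,i)`, in `ℍ`: the Wilson action's
dependence on the link variable `V = U(x,i)` is `V ↦ Σ_{k≠i} [Re P_{ik}(x) + Re P_{ik}(x−e_k)] = Re(V·S(x,i))`
(`re_mul_staple`), and `S(x,i)` does not involve `U(x,i)` (`staple_update`). -/
def staple (U : ZdGaugeConfig d (Metric.sphere (0 : ℍ) 1)) (x : Site d) (i : Fin d) : ℍ :=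
  ∑ k ∈ Finset.univ.erase i,
    (((stapleUp U x i k : (Metric.sphere (0 : ℍ) 1)) : ℍ) + ((stapleDown U x i k : (Metric.sphere (0 : ℍ) 1)) : ℍ))

/-- Link variable times upper staple = the plaquette above (coerced). -/
theorem coe_mul_stapleUp (U : ZdGaugeConfig d (Metric.sphere (0 : ℍ) 1)) (x : Site d) (i k : Fin d) :
    (U (x, i) : ℍ) * (stapleUp U x i k : ℍ) = ((ZdGaugeConfig.plaquette U x i k : (Metric.sphere (0 : ℍ) 1)) : ℍ) := by
  rw [← Metric.unitSphere.coe_mul, stapleUp, mul_stapleUp]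

/-- Link variable times lower staple = the inverse of the plaquette below, transported to `x` (coerced). -/
theorem coe_mul_stapleDown (U : ZdGaugeConfig d (Metric.sphere (0 : ℍ) 1)) (x : Site d) (i k : Fin d) :
    (U (x, i) : ℍ) * (stapleDown U x i k : ℍ) =
      Ad (U (x - Pi.single k 1, k))⁻¹
        (((ZdGaugeConfig.plaquette U (x - Pi.single k 1) i k)⁻¹ : (Metric.sphere (0 : ℍ) 1)) : ℍ) := by
  rw [← Metric.unitSphere.coe_mul, stapleDown, mul_stapleDown, ← coe_conj, inv_inv]

/-- **THE WILSON ACTION THROUGH A LINK.** `Re(U(x,i)·S(x,i)) = Σ_{k ≠ i} [Re P_{ik}(x) + Re P_{ik}(x−e_k)]` — the real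
parts (`½ Re tr` in `SU(2)` language) of the `2(d−1)` plaquettes containing the link. -/
theorem re_mul_staple (U : ZdGaugeConfig d (Metric.sphere (0 : ℍ) 1)) (x : Site d) (i : Fin d) :
    ((U (x, i) : ℍ) * staple U x i).re =
      ∑ k ∈ Finset.univ.erase i,
        (((ZdGaugeConfig.plaquette U x i k : (Metric.sphere (0 : ℍ) 1)) : ℍ).re +
          ((ZdGaugeConfig.plaquette U (x - Pi.single k 1) i k : (Metric.sphere (0 : ℍ) 1)) : ℍ).re) := by
  rw [staple, Finset.mul_sum, re_finset_sum]
  refine Finset.sum_congr rfl fun k _ => ?_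
  rw [mul_add, Quaternion.re_add, coe_mul_stapleUp, coe_mul_stapleDown, re_Ad, re_coe_inv]

/-- **THE EULER–LAGRANGE FORM.** `Im(U(x,i)·S(x,i)) = covDiv U x i`: the imaginary part of (link × staple sum) IS the
covariant divergence of the sine-curvature at the link. -/
theorem im_mul_staple (U : ZdGaugeConfig d (Metric.sphere (0 : ℍ) 1)) (x : Site d) (i : Fin d) :
    ((U (x, i) : ℍ) * staple U x i).im = covDiv U x i := by
  rw [staple, Finset.mul_sum, Literature.MathematicalPhysics.QuantumFieldTheory.Federbush1986.SU2.im_sum, covDiv, ← Finset.sum_erase Finset.univ (covDivSummand_self U x i)]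
  refine Finset.sum_congr rfl fun k _ => ?_
  rw [mul_add, Quaternion.im_add, coe_mul_stapleUp, coe_mul_stapleDown, im_Ad, im_coe_inv, map_neg, covDivSummand, curv,
    curv, ← sub_eq_add_neg]

/-- **(β₁) ON THE LATTICE: CRITICALITY ⇔ VANISHING COVARIANT DIVERGENCE.** The link variable `U(x,i)` is a critical
point of `V ↦ Re(V·S(x,i))` (the Wilson action's plaquettes through the link, `re_mul_staple`) along every tangent
direction `X·U(x,i)` of the unit sphere (`X` pure imaginary) iff `covDiv U x i = 0` — the lattice Yang–Mills equation
at the link, exact and LINEAR in the sine-curvatures `E`, with no small-field hypothesis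
(`QuaternionBianchiDefect.critical_iff_im_eq_zero` + `im_mul_staple`). -/
theorem critical_iff_covDiv_eq_zero (U : ZdGaugeConfig d (Metric.sphere (0 : ℍ) 1)) (x : Site d) (i : Fin d) :
    (∀ X : ℍ, X.re = 0 → ((X * (U (x, i) : ℍ)) * staple U x i).re = 0) ↔ covDiv U x i = 0 := by
  rw [critical_iff_im_eq_zero, im_mul_staple]

/-- The staple sum does not involve the link variable `U(x,i)` itself: replacing `U(x,i)` by any `V` leaves it
unchanged (so `V ↦ Re(V·S(x,i))` is exactly the `V`-dependence of the Wilson action through the link). -/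
theorem staple_update (U : ZdGaugeConfig d (Metric.sphere (0 : ℍ) 1)) (x : Site d) (i : Fin d)
    (V : (Metric.sphere (0 : ℍ) 1)) : staple (Function.update U (x, i) V) x i = staple U x i := by
  have hne : ∀ (y : Site d) (k : Fin d), (y, k) ≠ (x, i) → Function.update U (x, i) V (y, k) = U (y, k) :=
    fun y k h => Function.update_of_ne h V U
  refine Finset.sum_congr rfl fun k hk => ?_
  have hki : k ≠ i := Finset.ne_of_mem_erase hk
  have hk : (Pi.single k (1 : ℤ) : Site d) ≠ 0 := by
    intro h; have := congrFun h k; simp at this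
  have e1 : (x + Pi.single i 1, k) ≠ (x, i) := fun h => hki (Prod.ext_iff.1 h).2
  have e2 : (x + Pi.single k 1, i) ≠ (x, i) := fun h => hk (by simpa using (Prod.ext_iff.1 h).1)
  have e3 : (x, k) ≠ (x, i) := fun h => hki (Prod.ext_iff.1 h).2
  have e4 : (x + Pi.single i 1 - Pi.single k 1, k) ≠ (x, i) := fun h => hki (Prod.ext_iff.1 h).2
  have e5 : (x - Pi.single k 1, i) ≠ (x, i) := fun h => hk (by simpa using (Prod.ext_iff.1 h).1)
  have e6 : (x - Pi.single k 1, k) ≠ (x, i) := fun h => hki (Prod.ext_iff.1 h).2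
  simp only [stapleUp, stapleDown, hne _ _ e1, hne _ _ e2, hne _ _ e3, hne _ _ e4, hne _ _ e5, hne _ _ e6]

end Lattice

end

end Summit.QuantumFields.BalabanUV.T4Continuum.NE7b.CovariantDivergenceEL
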